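import Summits.BirchSwinnertonDyer.BirchSwinnertonDyer.Theses.TangentCone
import Summits.BirchSwinnertonDyer.BirchSwinnertonDyer.Theses.SelmerRank
import Literature.NumberTheory.EllipticCurves.SerreOpenImageFinalProofs
import Literature.NumberTheory.EllipticCurves.SupersingularDensityProofs
import Literature.NumberTheory.EllipticCurves.BSDSelmerCMPConverseRankOneProofs
import Literature.NumberTheory.EllipticCurves.BSDSelmerParityDokchitserProofs

/-!
# BirchSwinnertonDyer / TangentCone, SelmerRank — reduction of the crux `SelmerRankSmallImage`
(stmt-BirchSwinnertonDyer-14418) to the routes' sibling items and the CM core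

The crux `SelmerRankSmallImage` (byte-identical decl in routes TangentCone, SelmerRank,
ShadowIsolation, ToricShedding, FrozenTwin) is Selmer-rank BSD at ONE good ordinary prime `p ≥ 5`
in the small-image sector: `ρ̄_{E,p}` NOT surjective `⟹ corank_{ℤ_p} Sel_{p^∞}(E/ℚ) = ord_{s=1} L(E,s)`.

This file is the kernel-checked form of the line `prime-switch` (crux strategist, 2026-08-17;
`Cruxes/SelmerRankSmallImage/Lines/prime_switch.lean`) WITHOUT its stubs: it records, sorry-free,
that inside each wanting route the crux costs nothing beyond items the route already carries, three
printed theorems, and ONE open statement about CM curves.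

* **Prime switch (non-CM curves).** By Greenberg's identity
  `corank Sel_{p^∞} = rank E(ℚ) + corank Ш[p^∞]` (tree THEOREM
  `WeierstrassCurve.selmerCorank_eq_mordellWeilRank_add_holds`) the Selmer corank is the same at
  two primes as soon as the two `Ш`-coranks agree, in particular under the routes' own item
  `SelmerRankShaPFinite` (stmt-0132). A non-CM curve has a good ordinary prime `q ≥ 5` with
  SURJECTIVE `ρ̄_{E,q}` (`exists_goodOrdinary_surjective_of_not_hasCM`: Serre's open image theorem
  `serre_open_image_holds` + `infinite_goodOrdinaryPrimes_holds`, both PROVED in the tree), and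
  there the routes' big-image items give `corank_q = r_an` (`SelmerRankUB ∧ SelmerRankLB`, or
  TangentCone's `EdgeDecay ∧ EdgeCap ∧ SelmerRankLB` — the surjective branch of its certified
  `closes`).
* **Analytic rank `≤ 1`.** Gross–Zagier–Kolyvagin (TangentCone's own item `RankLeOne`
  = the named fact `rank_eq_analyticRank_of_analyticRank_le_one`) with the corank identity.
* **CM curves, `r_an ≥ 2`.** The Burungale–Tian `p`-converse theorems (named facts
  `burungaleTian_analyticRank_eq_{zero,one}_of_selmerCorank_eq_{zero,one}_of_hasCM`) force
  `corank_p ≥ 2`, the `p`-parity theorem (named fact `selmerCorank_mod_two_eq`,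
  Dokchitser–Dokchitser 2010 Thm 1.4) equal parity, and what is left is the hypothesis `hCore`:
  Selmer-rank BSD for CM curves at split ordinary primes when `min(corank_p, r_an) ≥ 2` — OPEN in
  print (Rubin's two-variable main conjecture bounds `corank_p` by the order of vanishing of the
  Katz `p`-adic `L`-function; its comparison with `r_an` in rank `≥ 2`, and any lower bound, are
  open). `hCore` is spelled out verbatim (it is the line's registered stub `stub_cmHighCore`), NOT
  introduced as a definition or a named fact.

Main theorems: `tangentCone_selmerRankSmallImage_of_items` (route TangentCone: items `EdgeDecay`,
`EdgeCap`, `SelmerRankLB`, `SelmerRankShaPFinite`, `RankLeOne` + three named facts + `hCore`) and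
`selmerRank_selmerRankSmallImage_of_items` (route SelmerRank: items `SelmerRankUB`, `SelmerRankLB`,
`SelmerRankShaPFinite` + GZK + three named facts + `hCore`). Everything here is CONDITIONAL (an
implication between open statements); no definition, no new named fact. Supports
stmt-BirchSwinnertonDyer-14418 (it does not close it).
-/

-- D-0017: single-problem summit, so `Summit.BirchSwinnertonDyer.BirchSwinnertonDyer.…` repeats a
-- namespace BY DESIGN.
set_option linter.dupNamespace false

namespace Summit.BirchSwinnertonDyer.BirchSwinnertonDyer.Theorems

open Summit.BirchSwinnertonDyer.BirchSwinnertonDyer.Theses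
open Literature.NumberTheory.EllipticCurves

/-! ### The prime supply and the corank transfer (proved) -/

/-- **Serre rung, proved in tree.** A non-CM elliptic curve over `ℚ` (globally minimal `W`) has a
prime `p ≥ 5` of good ordinary reduction at which `ρ̄_{E,p}` is surjective: Serre's open image
theorem (`serre_open_image_holds`, Serre 1972 §4.2 Thm 2) gives a threshold beyond which every
prime has surjective image, and the good ordinary primes are infinite
(`infinite_goodOrdinaryPrimes_holds`). [cite: Serre1972, §4.2 Théorème 2] -/
theorem exists_goodOrdinary_surjective_of_not_hasCM (W : WeierstrassCurve ℚ) [W.IsElliptic]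
    [W.IsGloballyMinimal] (hW : ¬ W.HasCM) :
    ∃ (p : ℕ) (_ : Fact p.Prime), 5 ≤ p ∧ W.HasGoodReductionAtPrime p ∧
      ¬ (p : ℤ) ∣ W.frobeniusTrace p ∧ W.HasSurjectiveModNGaloisRep p := by
  obtain ⟨p₀, hp₀⟩ := serre_open_image_holds W hW
  obtain ⟨p, ⟨hp, hgood, hord⟩, hlt⟩ :=
    (WeierstrassCurve.infinite_goodOrdinaryPrimes_holds W).exists_gt (max p₀ 4)
  have h5 : 5 ≤ p := by
    have := le_max_right p₀ 4
    omega
  have hle : p₀ ≤ p := by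
    have := le_max_left p₀ 4
    omega
  exact ⟨p, hp, h5, hgood, hord, hp₀ p hp.out hle⟩

/-- **Corank transfer between two primes.** Equal `Ш`-coranks give equal Selmer coranks — Greenberg's
identity `corank Sel_{ℓ^∞} = rank E(ℚ) + corank Ш[ℓ^∞]` (tree theorem
`selmerCorank_eq_mordellWeilRank_add_holds`) at `ℓ = p` and `ℓ = q`. [cite: GreenbergLNM1716, §1] -/
theorem selmerCorank_eq_selmerCorank_of_shaCorank_eq (W : WeierstrassCurve ℚ) [W.IsElliptic]
    (p q : ℕ) [Fact p.Prime] [Fact q.Prime] (h : W.shaCorank p = W.shaCorank q) :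
    W.selmerCorank p = W.selmerCorank q := by
  rw [W.selmerCorank_eq_mordellWeilRank_add_holds p, W.selmerCorank_eq_mordellWeilRank_add_holds q,
    h]

/-- **Corank transfer under prime-by-prime `Ш`-finiteness** (the routes' item `SelmerRankShaPFinite`,
stmt-0132, in its TangentCone spelling): the Selmer corank of `E/ℚ` does not depend on the prime,
since a finite `Ш[ℓ^∞]` has corank `0` (`Literature.BSD.shaCorank_eq_zero_of_finite`).
[cite: GreenbergLNM1716, §1] -/
theorem selmerCorank_eq_selmerCorank_of_shaPFinite
    (hSha : ∀ (W : WeierstrassCurve ℚ) [W.IsElliptic] (p : ℕ) [Fact p.Prime],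
      Finite (AddCommGroup.primaryComponent W.sha p))
    (W : WeierstrassCurve ℚ) [W.IsElliptic] (p q : ℕ) [Fact p.Prime] [Fact q.Prime] :
    W.selmerCorank p = W.selmerCorank q := by
  apply selmerCorank_eq_selmerCorank_of_shaCorank_eq
  rw [Literature.BSD.shaCorank_eq_zero_of_finite W p (hSha W p),
    Literature.BSD.shaCorank_eq_zero_of_finite W q (hSha W q)]

/-! ### The crux from the routes' items, three printed theorems and the CM core -/

/-- **Route TangentCone: `SelmerRankSmallImage` from the route's other items, three named facts and
the CM core.** Hypotheses: the route items `EdgeDecay`, `EdgeCap`, `SelmerRankLB`,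
`SelmerRankShaPFinite`, `RankLeOne` (= Gross–Zagier–Kolyvagin); the named facts `h0`, `h1`
(Burungale–Tian `p`-converses for CM curves in corank `0` / `1`) and `hPar` (Dokchitser–Dokchitser
`p`-parity); and `hCore`, Selmer-rank BSD for CM curves at split ordinary `p ≥ 5` when
`min(corank_p, r_an) ≥ 2` with equal parity (OPEN; the registered stub `stub_cmHighCore` of line
`prime-switch`, spelled out verbatim). Proof: `r_an ≤ 1` — GZK with the corank identity; CM — the
`p`-converses force `corank_p ≥ 2`, parity, core; non-CM — a Serre prime `q`
(`exists_goodOrdinary_surjective_of_not_hasCM`), the edge squeeze at the admissible prime returned by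
`EdgeDecay` (verbatim the surjective branch of the route's `closes`) with `SelmerRankLB` gives
`corank = r_an` there, and `SelmerRankShaPFinite` transfers the corank to `p`. CONDITIONAL (every
hypothesis but the three named facts is an open route statement). [folklore] -/
theorem tangentCone_selmerRankSmallImage_of_items :
    Summit.BirchSwinnertonDyer.BirchSwinnertonDyer.Theses.TangentCone.EdgeDecay →
    Summit.BirchSwinnertonDyer.BirchSwinnertonDyer.Theses.TangentCone.EdgeCap →
    Summit.BirchSwinnertonDyer.BirchSwinnertonDyer.Theses.TangentCone.SelmerRankLB →
    Summit.BirchSwinnertonDyer.BirchSwinnertonDyer.Theses.TangentCone.SelmerRankShaPFinite →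
    Summit.BirchSwinnertonDyer.BirchSwinnertonDyer.Theses.TangentCone.RankLeOne →
    Literature.NumberTheory.EllipticCurves.burungaleTian_analyticRank_eq_zero_of_selmerCorank_eq_zero_of_hasCM →
    Literature.NumberTheory.EllipticCurves.burungaleTian_analyticRank_eq_one_of_selmerCorank_eq_one_of_hasCM →
    (∀ (W : WeierstrassCurve ℚ) [W.IsElliptic] (p : ℕ) [Fact p.Prime],
      Literature.NumberTheory.EllipticCurves.selmerCorank_mod_two_eq W p) →
    (∀ (W : WeierstrassCurve ℚ) [W.IsElliptic] [W.IsGloballyMinimal] (p : ℕ) [Fact p.Prime],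
      5 ≤ p → W.HasGoodReductionAtPrime p → ¬ (p : ℤ) ∣ W.frobeniusTrace p → W.HasCM →
        2 ≤ W.analyticRank → 2 ≤ W.selmerCorank p →
          W.selmerCorank p % 2 = W.analyticRank % 2 → W.selmerCorank p = W.analyticRank) →
    Summit.BirchSwinnertonDyer.BirchSwinnertonDyer.Theses.TangentCone.SelmerRankSmallImage := by
  intro hE hC hLB hSha hR1 h0 h1 hPar hCore W _ _ p _ h5 hgood hord _hns
  by_cases hr1 : W.analyticRank ≤ 1
  · -- analytic rank ≤ 1: Gross–Zagier–Kolyvagin (the route item `RankLeOne`) + corank identity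
    exact selmerCorank_eq_analyticRank_of_analyticRank_le_one hR1 W p hr1
  · have h2 : 2 ≤ W.analyticRank := by omega
    by_cases hCM : W.HasCM
    · -- CM: p-converses (contrapositive) give corank ≥ 2, parity, core
      have hpar : W.selmerCorank p % 2 = W.analyticRank % 2 := hPar W p
      have hc : 2 ≤ W.selmerCorank p := by
        by_contra hlt
        have hle : W.selmerCorank p ≤ 1 := by omega
        have := selmerCorank_eq_analyticRank_of_hasCM_of_selmerCorank_le_one h0 h1 W hCM p h5
          hgood hord hle
        omega
      exact hCore W p h5 hgood hord hCM h2 hc hpar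
    · -- non-CM: Serre prime, edge squeeze there, transfer by Ш-finiteness
      obtain ⟨p₀, hp₀, h5₀, hgood₀, hord₀, hsurj₀⟩ := exists_goodOrdinary_surjective_of_not_hasCM W hCM
      obtain ⟨hN, q, hq, h5', hgood', hord', hna, hsurj', hBr, a, b, hb, hab, hJ⟩ :=
        hE W h2 ⟨p₀, hp₀, h5₀, hgood₀, hord₀, hsurj₀⟩
      obtain ⟨J, C₁, hcap⟩ := hC W hN q h5' hgood' hord' hna hsurj' hBr a b hb hab
      obtain ⟨C₂, hm⟩ := hJ J
      have hq1 : (1 : ℝ) < (q : ℝ) := by exact_mod_cast hq.out.one_lt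
      have hq0 : (0 : ℝ) < (q : ℝ) := lt_trans zero_lt_one hq1
      have key : ∀ m : ℕ, W.selmerCorank q * (1 + m) ≤ W.analyticRank * (m + 1) + (C₁ + C₂) := by
        intro m
        obtain ⟨k, g, ι, s, hdiv, hkJ, hs, hnew, hordg, hcong, hall⟩ := hm m
        have hdiv' : (2 * b * (q - 1) : ℤ) ∣ (k - 2) := (Dvd.intro _ rfl).trans hdiv
        obtain ⟨j, hjodd, hj3, hjJ, hcapj⟩ := hcap k g ι s hdiv' hkJ hs hnew hordg hcong
        obtain ⟨hR, hlow⟩ := hall j hjodd hj3 hjJ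
        have hup := hcapj hR
        have hk0 : (k - 2) ≠ 0 := by omega
        have hpm : ((q : ℤ) ^ m) ∣ (k - 2) := (Dvd.intro_left _ rfl).trans hdiv
        have hmv : m ≤ padicValInt q (k - 2) := by
          rcases (padicValInt_dvd_iff m (k - 2)).mp hpm with h | h
          · exact absurd h hk0
          · exact h
        set x : ℝ := ‖ι ⟨_, hR⟩‖ with hx
        have hx0 : 0 ≤ x := norm_nonneg _
        set e₁ : ℕ := W.selmerCorank q * (1 + padicValInt q (k - 2)) with he₁
        set e₂ : ℕ := W.analyticRank * (m + 1) + C₂ with he₂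
        have hpow : (q : ℝ) ^ e₁ ≤ (q : ℝ) ^ (C₁ + e₂) := by
          calc (q : ℝ) ^ e₁ = (q : ℝ) ^ e₁ * 1 := by ring
            _ ≤ (q : ℝ) ^ e₁ * (x * (q : ℝ) ^ e₂) :=
                mul_le_mul_of_nonneg_left hlow (pow_nonneg hq0.le _)
            _ = (x * (q : ℝ) ^ e₁) * (q : ℝ) ^ e₂ := by ring
            _ ≤ (q : ℝ) ^ C₁ * (q : ℝ) ^ e₂ :=
                mul_le_mul_of_nonneg_right hup (pow_nonneg hq0.le _)
            _ = (q : ℝ) ^ (C₁ + e₂) := (pow_add (q : ℝ) C₁ e₂).symm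
        have hexp : e₁ ≤ C₁ + e₂ := (pow_le_pow_iff_right₀ hq1).mp hpow
        have hmono : W.selmerCorank q * (1 + m) ≤ e₁ :=
          Nat.mul_le_mul_left _ (by omega)
        omega
      have hUB : W.selmerCorank q ≤ W.analyticRank := by
        have hk := key (C₁ + C₂)
        by_contra hlt
        push Not at hlt
        have h1' : (W.analyticRank + 1) * (1 + (C₁ + C₂)) ≤ W.selmerCorank q * (1 + (C₁ + C₂)) :=
          Nat.mul_le_mul_right _ hlt
        nlinarith
      have hcor : W.selmerCorank q = W.analyticRank :=
        le_antisymm hUB (hLB W q h5' hgood' hord' hsurj')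
      rw [← hcor]
      exact selmerCorank_eq_selmerCorank_of_shaPFinite hSha W p q

/-- **Route SelmerRank: `SelmerRankSmallImage` from `SelmerRankUB`, `SelmerRankLB`,
`SelmerRankShaPFinite`, Gross–Zagier–Kolyvagin, three named facts and the CM core.** As
`tangentCone_selmerRankSmallImage_of_items`, with the big-image anchor taken directly from
`SelmerRankUB ∧ SelmerRankLB` at the Serre prime, and GZK as the named fact
`rank_eq_analyticRank_of_analyticRank_le_one` (route SelmerRank carries no `RankLeOne` item).
Routes ShadowIsolation / ToricShedding / FrozenTwin carry the same `UB`-type, `LB` and `Ш` items up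
to spelling. CONDITIONAL. [folklore] -/
theorem selmerRank_selmerRankSmallImage_of_items (hUB : SelmerRank.SelmerRankUB)
    (hLB : SelmerRank.SelmerRankLB) (hSha : SelmerRank.SelmerRankShaPFinite)
    (hGZK : rank_eq_analyticRank_of_analyticRank_le_one)
    (h0 : burungaleTian_analyticRank_eq_zero_of_selmerCorank_eq_zero_of_hasCM)
    (h1 : burungaleTian_analyticRank_eq_one_of_selmerCorank_eq_one_of_hasCM)
    (hPar : ∀ (W : WeierstrassCurve ℚ) [W.IsElliptic] (p : ℕ) [Fact p.Prime],
      selmerCorank_mod_two_eq W p)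
    (hCore : ∀ (W : WeierstrassCurve ℚ) [W.IsElliptic] [W.IsGloballyMinimal] (p : ℕ) [Fact p.Prime],
      5 ≤ p → W.HasGoodReductionAtPrime p → ¬ (p : ℤ) ∣ W.frobeniusTrace p → W.HasCM →
        2 ≤ W.analyticRank → 2 ≤ W.selmerCorank p →
          W.selmerCorank p % 2 = W.analyticRank % 2 → W.selmerCorank p = W.analyticRank) :
    SelmerRank.SelmerRankSmallImage := by
  intro W _ _ p _ h5 hgood hord _hns
  by_cases hr1 : W.analyticRank ≤ 1
  · exact selmerCorank_eq_analyticRank_of_analyticRank_le_one hGZK W p hr1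
  · have h2 : 2 ≤ W.analyticRank := by omega
    by_cases hCM : W.HasCM
    · have hpar : W.selmerCorank p % 2 = W.analyticRank % 2 := hPar W p
      have hc : 2 ≤ W.selmerCorank p := by
        by_contra hlt
        have hle : W.selmerCorank p ≤ 1 := by omega
        have := selmerCorank_eq_analyticRank_of_hasCM_of_selmerCorank_le_one h0 h1 W hCM p h5
          hgood hord hle
        omega
      exact hCore W p h5 hgood hord hCM h2 hc hpar
    · obtain ⟨q, hq, h5q, hgoodq, hordq, hsurjq⟩ := exists_goodOrdinary_surjective_of_not_hasCM W hCM
      have hcor : W.selmerCorank q = W.analyticRank :=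
        le_antisymm (hUB W q h5q hgoodq hordq hsurjq) (hLB W q h5q hgoodq hordq hsurjq)
      rw [← hcor]
      exact selmerCorank_eq_selmerCorank_of_shaPFinite hSha W p q

end Summit.BirchSwinnertonDyer.BirchSwinnertonDyer.Theorems
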